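import Summits.BirchSwinnertonDyer.BirchSwinnertonDyer.Theorems.ManinLocalTwoThreeEvenManinKummerSquare
import Literature.NumberTheory.EllipticCurves.CuspidalReductionInfiniteHeightProofs
import Literature.NumberTheory.EllipticCurves.NoConductorOne
import HarnessLib

/-!
# Arithmetic at the additive prime `3` for E-an-55: `a₃ₘ = 0`, `3 ∣ c₄`, `27 ∣ c₆`, the `3`-integral
# short model `E♮` has cuspidal reduction, hence `log_{E♮}, exp_{E♮} ∈ ℤ₃⟦T⟧`; thirding in the formal group

Summit `BirchSwinnertonDyer`, route `ManinLocalTwoThree` (cell bsd-f2-manin), crux C3 `ManinPrimeToThreeAtNine`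
(stmt-BirchSwinnertonDyer-22968); third brick of the proof of E-an-55 `…CuspidalKummerThree.ManinThreeKummerCube`
(after `…KummerTriplingKubert`, `…KummerTriplingSeries`).  This is the `p = 3` port of §5 of
`ManinLocalTwoThreeEvenManinKummerSquare` (p2, `p = 2`), with ONE difference: at `p = 2` the integrality of
`log/exp` of the short model came from the parity of `ω`; at `p = 3` it comes from Honda's remark that a
formal group with `[p] ≡ 0 (mod p)` is of type `p` — the tree's `CuspidalReductionInfiniteHeightProofs`
(`formalMul_prime_map_toZMod_eq_zero_of_cuspidal`) and `FormalGroupInfiniteHeightProofs`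
(`isPadicInt_formalLog_of_formalMul_prime_eq_zero`, `norm_coeff_formalExp_le_one_of_formalMul_prime_eq_zero`).

* `lFunction_three_eq_zero_of_nine_dvd`, `lFunction_eq_zero_of_three_dvd`,
  `hasAdditiveReductionAt_three_of_lFunction_three_eq_zero`, `three_dvd_Δ_and_c₄_of_hasAdditiveReductionAt`:
  `9 ∣ N ⇒ a₃(E) = 0`, `3 ∣ N_E`, `aₙ(E) = 0` for `3 ∣ n`, additive reduction at `3`, `3 ∣ Δ_min`, `3 ∣ c₄`
  (Atkin–Lehner; Silverman VII.5.1(c));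
* `exists_padicInt_shortModel_three`: `3 ∣ c₄ ⇒ 3 ∣ b₂ ⇒ 27 ∣ c₆` (`NoConductorOne.dvd_c₆_of_three_dvd_c₄`), so
  `E♮ = shortModel W 1 : y² = x³ − (c₄/48)x − c₆/864` is `3`-INTEGRAL: a model `V♮/ℤ₃` with `V♮ ⊗ ℚ₃ = E♮ ⊗ ℚ₃`,
  whose reduction is CUSPIDAL (`c̃₄ = Δ̃ = 0`), hence `log_{E♮}, exp_{E♮} ∈ ℤ₃⟦T⟧`;
* `eq_formalMul_subst_formalExp_of_formalLog_subst'`: dividing by `n` in the formal group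
  (`log D = n c′·L ⇒ D = [n](exp(c′L))`; p2's lemma is `n = 2`);
* `padic_norm_inv_natCast_of_not_dvd`: `‖m⁻¹‖_p = 1` for `p ∤ m`.

No definitions; nothing about BSD, Manin's conjecture or any Manin constant is asserted.
-/

set_option autoImplicit false
set_option linter.dupNamespace false

noncomputable section

open scoped Classical MatrixGroups ModularForm
open PowerSeries CongruenceSubgroup IsDedekindDomain NumberField Rat.HeightOneSpectrum
open WeierstrassCurve Literature.NumberTheory.EllipticCurves Literature.NumberTheory.EllipticCurves.ModularForms
  Literature.RingTheory.FormalGroups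
open Summit.BirchSwinnertonDyer.Rank1Residual.ManinAdditive.CuspidalKummer

namespace Summit.BirchSwinnertonDyer.BirchSwinnertonDyer.Theorems.ManinLocalTwoThree

/-! ### §1 `aₙ = 0` for `3 ∣ n` and additive reduction at `3` -/

section Arith

variable {N : ℕ} [NeZero N] (W : WeierstrassCurve ℚ) [W.IsElliptic]

/-- **`9 ∣ N ⇒ a₃(E) = 0` and `3 ∣ N_E`** for the newform of `E` at level `N` (Atkin–Lehner 1970, Thm. 3:
`p² ∣ N ⇒ a_p(f) = 0`; the level and the conductor share their primes). [cite: AtkinLehner1970, Thm. 3] -/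
theorem lFunction_three_eq_zero_of_nine_dvd {f : CuspForm (Gamma0 N) 2} (hf : IsNewformOf W f)
    (h9 : 9 ∣ N) : W.LFunction 3 = 0 ∧ 3 ∣ W.conductorNorm ℤ := by
  have h33 : 3 ^ 2 ∣ N := by norm_num; exact h9
  have h0 := hf.1.cuspCoeff_eq_zero_of_sq_dvd Nat.prime_three h33
  rw [hf.2 3] at h0
  refine ⟨by exact_mod_cast h0, (hf.dvd_level_iff_dvd_conductorNorm Nat.prime_three).mp
    (dvd_trans ⟨3, by norm_num⟩ h9)⟩

/-- **`aₙ(E) = 0` for every `n ≥ 1` with `3 ∣ n`** once `a₃(E) = 0` and `3 ∣ N_E` (`a_{3^{k+2}} =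
a₃a_{3^{k+1}} − 𝟙_{N_E}(3)·3·a_{3^k}`, multiplicativity). [cite: DiamondShurman2005, (8.44)] -/
theorem lFunction_eq_zero_of_three_dvd (h3 : W.LFunction 3 = 0) (hN : 3 ∣ W.conductorNorm ℤ)
    {n : ℕ} (hn0 : n ≠ 0) (hn : 3 ∣ n) : W.LFunction n = 0 := by
  obtain ⟨k, m, hm, rfl⟩ := Nat.exists_eq_pow_mul_and_not_dvd hn0 3 (by norm_num)
  have hk : k ≠ 0 := by
    rintro rfl; rw [pow_zero, one_mul] at hn; exact hm hn
  have hpow : ∀ j : ℕ, W.LFunction (3 ^ (j + 1)) = 0 := by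
    intro j
    induction j with
    | zero => rw [zero_add, pow_one]; exact h3
    | succ j ih =>
      rw [show j + 1 + 1 = j + 2 by ring, W.LFunction_apply_prime_pow_add_two_of_prime Nat.prime_three j,
        if_pos hN, h3, ih]
      ring
  have hcop : Nat.Coprime (3 ^ k) m :=
    (Nat.Coprime.pow_left k ((Nat.Prime.coprime_iff_not_dvd Nat.prime_three).mpr hm))
  obtain ⟨j, rfl⟩ := Nat.exists_eq_succ_of_ne_zero hk
  rw [W.isMultiplicative_LFunction.map_mul_of_coprime hcop, hpow j, zero_mul]

/-- **Additive reduction at `3` from `a₃(E) = 0` and `3 ∣ N_E`**: the place over `3` is bad, and a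
multiplicative place would have `a₃(E) = ±1`. [cite: SilvermanAEC2009, §C.16 (definition of L_v(T))] -/
theorem hasAdditiveReductionAt_three_of_lFunction_three_eq_zero (h3 : W.LFunction 3 = 0)
    (hN : 3 ∣ W.conductorNorm ℤ) :
    W.HasAdditiveReductionAt ((primesEquiv (R := 𝓞 ℚ)).symm ⟨3, Nat.prime_three⟩) := by
  set v : HeightOneSpectrum (𝓞 ℚ) := (primesEquiv (R := 𝓞 ℚ)).symm ⟨3, Nat.prime_three⟩ with hv
  have hpv : primesEquiv v = ⟨3, Nat.prime_three⟩ := (primesEquiv (R := 𝓞 ℚ)).apply_symm_apply _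
  have hbad : ¬ W.HasGoodReductionAt v :=
    W.not_hasGoodReductionAt_ringOfIntegers_of_dvd_conductorNorm ⟨3, Nat.prime_three⟩ hN
  rcases hasGoodReductionAt_or_hasMultiplicativeReductionAt_or_hasAdditiveReductionAt v W with
    hg | hm | ha
  · exact absurd hg hbad
  · exfalso
    by_cases hs : W.HasSplitMultiplicativeReductionAt v
    · have h := W.LFunction_apply_primesEquiv_of_hasSplitMultiplicativeReductionAt hs
      rw [hpv] at h; change W.LFunction 3 = 1 at h; rw [h3] at h; exact zero_ne_one h
    · have h := W.LFunction_apply_primesEquiv_of_hasMultiplicativeReductionAt_of_not_split hm hs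
      rw [hpv] at h; change W.LFunction 3 = -1 at h; rw [h3] at h; norm_num at h
  · exact ha

/-- **At an additive place `3` of a globally minimal `W`: `3 ∣ Δ_min` and `3 ∣ c₄`** (Silverman *AEC*
VII.5.1(c)). [cite: SilvermanAEC2009, VII.5 Prop. 5.1(c)] -/
theorem three_dvd_Δ_and_c₄_of_hasAdditiveReductionAt [W.IsGloballyMinimal]
    (ha : W.HasAdditiveReductionAt ((primesEquiv (R := 𝓞 ℚ)).symm ⟨3, Nat.prime_three⟩)) :
    (3 : ℤ) ∣ (integralModelInt W).Δ ∧ (3 : ℤ) ∣ (integralModelInt W).c₄ := by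
  set M : WeierstrassCurve ℤ := integralModelInt W with hM
  have hWM : M.map (Int.castRingHom ℚ) = W := map_integralModelInt W
  set v : HeightOneSpectrum ℤ := (primesEquiv (R := ℤ)).symm ⟨3, Nat.prime_three⟩ with hv
  have haZ : W.HasAdditiveReductionAt v :=
    (W.hasAdditiveReductionAt_int_iff_ringOfIntegers ⟨3, Nat.prime_three⟩).mpr ha
  have hgen : natGenerator v = 3 :=
    Literature.NumberTheory.EllipticCurves.Rat.natGenerator_primesEquiv_symm ⟨3, Nat.prime_three⟩
  have hgen3 : (natGenerator v : ℤ) = 3 := by exact_mod_cast hgen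
  have hmin : W.IsMinimalAt v := IsGloballyMinimal.isMinimalAt_int W v
  obtain ⟨hΔ, hc₄⟩ := (hasAdditiveReductionAt_iff_of_isMinimalAt hmin).mp haZ
  rw [← hWM, map_Δ, eq_intCast,
    Literature.NumberTheory.EllipticCurves.Rat.valuation_intCast_lt_one_iff v, hgen3] at hΔ
  rw [← hWM, map_c₄, eq_intCast,
    Literature.NumberTheory.EllipticCurves.Rat.valuation_intCast_lt_one_iff v, hgen3] at hc₄
  exact ⟨hΔ, hc₄⟩

end Arith

/-! ### §2 The `3`-integral short model `E♮` and the integrality of `log`, `exp` -/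

section ShortModel

/-- `‖m⁻¹‖_p = 1` for an integer `m` prime to `p`. [folklore] -/
theorem padic_norm_inv_natCast_of_not_dvd {p : ℕ} [Fact p.Prime] {m : ℕ} (hm : ¬ p ∣ m) :
    ‖((m : ℚ_[p]))⁻¹‖ = 1 := by
  have hle : ‖((m : ℤ) : ℚ_[p])‖ ≤ 1 := Padic.norm_int_le_one (m : ℤ)
  have hnlt : ¬ ‖((m : ℤ) : ℚ_[p])‖ < 1 := by
    rw [Padic.norm_intCast_lt_one_iff]
    intro h
    exact hm (by exact_mod_cast h)
  have h1 : ‖((m : ℤ) : ℚ_[p])‖ = 1 := le_antisymm hle (not_lt.mp hnlt)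
  rw [Int.cast_natCast] at h1
  rw [norm_inv, h1, inv_one]

variable (W : WeierstrassCurve ℚ) [W.IsElliptic] [W.IsGloballyMinimal]

/-- **The `3`-integral short model at an additive prime `3`.**  If `3 ∣ Δ_min(W)` and `3 ∣ c₄(W)` then
`3 ∣ b₂`, `27 ∣ c₆` (`NoConductorOne.dvd_c₆_of_three_dvd_c₄`), so `E♮ = shortModel W 1 : y² = x³ − (c₄/48)x
− c₆/864` is the base change of a Weierstrass equation `V♮` over `ℤ₃` whose reduction is cuspidal
(`c₄(V♮) = c₄(W)`, `Δ(V♮) = Δ(W)` vanish mod `3`); hence `[3]˜ = 0` and `log_{E♮}, exp_{E♮} ∈ ℤ₃⟦T⟧`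
(Honda type `p` at infinite height). [cite: Honda1970, Thm. 2 (p. 223)] [cite: SilvermanAEC2009, VII.5 Prop. 5.1(c)] -/
theorem exists_padicInt_shortModel_three (hΔ : (3 : ℤ) ∣ (integralModelInt W).Δ)
    (hc₄ : (3 : ℤ) ∣ (integralModelInt W).c₄) :
    ∃ V : WeierstrassCurve ℤ_[3], V.a₁ = 0 ∧ V.a₂ = 0 ∧ V.a₃ = 0 ∧
      V.map PadicInt.Coe.ringHom = (shortModel W 1).map (algebraMap ℚ ℚ_[3]) ∧
      (V.map PadicInt.Coe.ringHom).IsElliptic ∧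
      IsPadicInt (V.map PadicInt.Coe.ringHom).formalLog ∧ IsPadicInt (V.map PadicInt.Coe.ringHom).formalExp := by
  set M : WeierstrassCurve ℤ := integralModelInt W with hM
  have hWM : M.map (Int.castRingHom ℚ) = W := map_integralModelInt W
  obtain ⟨κ, hκ⟩ := hc₄
  obtain ⟨μ, hμ⟩ := M.dvd_c₆_of_three_dvd_c₄ ⟨κ, hκ⟩
  have hWc₄ : W.c₄ = ((3 * κ : ℤ) : ℚ) := by rw [← hWM, map_c₄, hκ]; simp
  have hWc₆ : W.c₆ = ((27 * μ : ℤ) : ℚ) := by rw [← hWM, map_c₆, hμ]; simp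
  have hWΔ : W.Δ = ((M.Δ : ℤ) : ℚ) := by rw [← hWM, map_Δ]; simp
  have ha₄ : (shortModel W 1).a₄ = -((κ : ℚ) / 16) := by
    simp only [shortModel, hWc₄]; push_cast; ring
  have ha₆ : (shortModel W 1).a₆ = -((μ : ℚ) / 32) := by
    simp only [shortModel, hWc₆]; push_cast; ring
  have hrat : ∀ q : ℚ, algebraMap ℚ ℚ_[3] q = (q : ℚ_[3]) := fun q => by rw [eq_ratCast]
  have h16 : ‖((16 : ℕ) : ℚ_[3])⁻¹‖ = 1 := padic_norm_inv_natCast_of_not_dvd (by decide)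
  have h32 : ‖((32 : ℕ) : ℚ_[3])⁻¹‖ = 1 := padic_norm_inv_natCast_of_not_dvd (by decide)
  have hA : ‖algebraMap ℚ ℚ_[3] (shortModel W 1).a₄‖ ≤ 1 := by
    rw [hrat, ha₄]; push_cast
    rw [norm_neg, div_eq_mul_inv, norm_mul, show (16 : ℚ_[3]) = ((16 : ℕ) : ℚ_[3]) by norm_cast, h16,
      mul_one]
    exact Padic.norm_int_le_one κ
  have hB : ‖algebraMap ℚ ℚ_[3] (shortModel W 1).a₆‖ ≤ 1 := by
    rw [hrat, ha₆]; push_cast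
    rw [norm_neg, div_eq_mul_inv, norm_mul, show (32 : ℚ_[3]) = ((32 : ℕ) : ℚ_[3]) by norm_cast, h32,
      mul_one]
    exact Padic.norm_int_le_one μ
  set A₀ : ℤ_[3] := ⟨_, hA⟩ with hA₀
  set B₀ : ℤ_[3] := ⟨_, hB⟩ with hB₀
  set V : WeierstrassCurve ℤ_[3] := ⟨0, 0, 0, A₀, B₀⟩ with hVdef
  have hVE : V.map PadicInt.Coe.ringHom = (shortModel W 1).map (algebraMap ℚ ℚ_[3]) := by
    ext <;> simp [hVdef, shortModel, hA₀, hB₀]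
  -- `Δ(E♮) = Δ(W)`, `c₄(E♮) = c₄(W)`
  have hΔ1 : (shortModel W 1).Δ = W.Δ := by
    have hc := W.c_relation
    simp only [shortModel, WeierstrassCurve.Δ, WeierstrassCurve.b₂, WeierstrassCurve.b₄,
      WeierstrassCurve.b₆, WeierstrassCurve.b₈, Int.cast_one, one_pow, one_mul] at hc ⊢
    simp only [WeierstrassCurve.c₄, WeierstrassCurve.c₆, WeierstrassCurve.b₂, WeierstrassCurve.b₄,
      WeierstrassCurve.b₆] at hc ⊢
    linear_combination (1 / 1728 : ℚ) * hc
  have hc₄1 : (shortModel W 1).c₄ = W.c₄ := by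
    simp only [shortModel, WeierstrassCurve.c₄, WeierstrassCurve.b₂, WeierstrassCurve.b₄, Int.cast_one, one_pow,
      one_mul]
    ring
  have hEll : (V.map PadicInt.Coe.ringHom).IsElliptic := by
    rw [hVE]
    refine ⟨?_⟩
    rw [map_Δ, hΔ1, isUnit_iff_ne_zero]
    exact (map_ne_zero _).mpr (WeierstrassCurve.isUnit_Δ W).ne_zero
  -- cuspidal reduction
  have hinj : Function.Injective (PadicInt.Coe.ringHom (p := 3)) := fun a b h => Subtype.ext h
  have hVΔ : V.Δ = ((M.Δ : ℤ) : ℤ_[3]) := by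
    apply hinj
    have h := congrArg WeierstrassCurve.Δ hVE
    rw [map_Δ, map_Δ, hΔ1, hWΔ, hrat] at h
    rw [h, map_intCast, Rat.cast_intCast]
  have hVc₄ : V.c₄ = ((3 * κ : ℤ) : ℤ_[3]) := by
    apply hinj
    have h := congrArg WeierstrassCurve.c₄ hVE
    rw [map_c₄, map_c₄, hc₄1, hWc₄, hrat] at h
    rw [h, map_intCast, Rat.cast_intCast]
  have h0 : (V.map PadicInt.toZMod).formalMul 3 = 0 := by
    refine V.formalMul_prime_map_toZMod_eq_zero_of_cuspidal ?_ ?_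
    · rw [map_c₄, hVc₄, map_intCast, ZMod.intCast_zmod_eq_zero_iff_dvd]
      exact ⟨κ, by push_cast; ring⟩
    · rw [map_Δ, hVΔ, map_intCast, ZMod.intCast_zmod_eq_zero_iff_dvd]
      exact_mod_cast hΔ
  exact ⟨V, rfl, rfl, rfl, hVE, hEll, V.isPadicInt_formalLog_of_formalMul_prime_eq_zero h0,
    isPadicInt_iff_coeff.mpr (V.norm_coeff_formalExp_le_one_of_formalMul_prime_eq_zero h0)⟩

end ShortModel

/-! ### §3 Dividing by `n` in the formal group -/

section Padic

variable {p : ℕ} [Fact p.Prime] (W : WeierstrassCurve ℚ_[p]) [hW : W.IsIntegral ℤ_[p]]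

/-- **Dividing by `n` in the formal group.** If `log_W(D) = c·L` with `c = n·c'`, then
`D = [n](exp_W(c'·L))` (both sides have formal logarithm `c·L`: `log[n] = n log`, `log ∘ exp = id`;
p2's `eq_formalMul_two_subst_formalExp_of_formalLog_subst` is `n = 2`). [Silverman AEC IV.5.5] [folklore] -/
theorem eq_formalMul_subst_formalExp_of_formalLog_subst' (n : ℕ) {D L : ℚ_[p]⟦X⟧}
    (hD : constantCoeff D = 0) (hL : constantCoeff L = 0) {c c' : ℚ_[p]} (hc : c = n * c')
    (hlog : W.formalLog.subst D = C c * L) :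
    D = (W.formalMul n).subst (W.formalExp.subst (C c' * L)) := by
  have hu0 : constantCoeff (C c' * L) = 0 := by rw [map_mul, hL, mul_zero]
  have hus : HasSubst (C c' * L) := HasSubst.of_constantCoeff_zero' hu0
  set s := W.formalExp.subst (C c' * L) with hs
  have hs0 : constantCoeff s = 0 := by
    rw [hs, Literature.RingTheory.FormalGroups.constantCoeff_subst_of_constantCoeff_eq_zero hu0,
      W.constantCoeff_formalExp]
  have hss : HasSubst s := HasSubst.of_constantCoeff_zero' hs0
  have hn0 : constantCoeff ((W.formalMul n).subst s) = 0 := by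
    rw [Literature.RingTheory.FormalGroups.constantCoeff_subst_of_constantCoeff_eq_zero hs0,
      W.constantCoeff_formalMul]
  refine eq_of_formalLog_subst_eq W hD hn0 ?_
  have key := congrArg (PowerSeries.subst s) (W.formalLog_subst_formalMul n)
  rw [subst_comp_subst_apply (W.hasSubst_formalMul n) hss, nsmul_eq_mul,
    show ((n : ℚ_[p]⟦X⟧)) = C (n : ℚ_[p]) from (map_natCast C n).symm, subst_mul hss, C_subst, hs,
    formalLog_subst_formalExp_subst W hu0] at key
  rw [key, hlog, hc, map_mul]
  ring

end Padic

end Summit.BirchSwinnertonDyer.BirchSwinnertonDyer.Theorems.ManinLocalTwoThree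

end
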